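import Summits.Ventures.YMGap.RobustBall.MemberPressure
import Summits.Ventures.YMGap.RobustBall.TorusEnergyVarianceCeilingBall
import Summits.Ventures.YMGap.RobustBall.RowsSU2StarVar
import HarnessLib

/-!
# Venture YMGap, track ROBUST-BALL (Y2) — THE CURVATURE CEILING OF THE MEMBER FREE ENERGIES INSIDE THE DOOR, uniform in the volume, and
# NO FIRST-ORDER TRANSITION: every thermodynamic limit of member free energies is differentiable inside the door

HONEST FRAMING. WHAT THIS IS: a venture file (cell `pub-ymgap`, track Y2 ROBUST-BALL, seat rb-p2, theorems only, 0 compute).  Finite-volume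
(torus) LATTICE statements about the member pressures `p_{L,W}(t) = L^{−d} log Z_{Λ_L,t,W}` of rb-theory's tier-1 torus ball
`ClusterDomainFR ε₀ ε₁ r` (`G = SU(N)`), INSIDE the robust Dobrushin door (hypothesis = ds-2's clustering currency `ClustersWith` /
`TorusClusteringOnBallUpTo`, hypothesis-free on the certified cells), and their pointwise limits when such limits exist (no existence claim):
* ★★ `convexOn_sq_sub_memberPressure` — CURVATURE CEILING: if `W` clusters with `(A, m)` (`A ≥ 0`, `m > 0`) at every coupling of `[lo, hi]`,
  then `t ↦ (M/2) t² − p_{L,W}(t)` is convex on `[lo, hi]`, `M = 16 N A e^{2m} · #orient² · ((1+e^{−m/d})/(1−e^{−m/d}))^d` (`p″ ≤ M`), ONE `M`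
  for all volumes and all members with these constants (`TorusEnergyVarianceCeilingBall.variance_wilsonAction_le_of_clustersWith` +
  `MemberPressure.convexOn_sq_sub_mul_cgf`); `convexOn_sq_sub_memberPressure_onBallUpTo` — from `TorusClusteringOnBallUpTo N d βs ε₀ ε₁ r A m`
  on `[0, βs]`, every member, every `L ≥ 3`; ★★ `memberEnergy_decrement_le` — in finite volume the member's mean energy density is `M`-Lipschitz in
  the coupling inside the door, uniformly in `L` and `W` (floor: `TorusEnergyStrictMonoBall`).
* ★★★ `differentiableAt_of_tendsto_memberPressure` — NO FIRST-ORDER TRANSITION ON THE BALL INSIDE THE DOOR: if member pressures `p_{L_n,W_n}`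
  (`L_n ≥ 3`, `W_n ∈ ClusterDomainFR ε₀ ε₁ r`, the ball carrying `TorusClusteringOnBallUpTo … βs … A m`) converge pointwise to `f` on `[0, βs]`,
  then `f` is DIFFERENTIABLE at every `x ∈ (0, βs)` — the limit free energy is convex (limit of convex pressures) and `M`-semiconcave (limit of
  the ceiling), hence has no kink: no latent heat in the coupling for any infinite-volume free energy of members, whatever the members and
  the volumes; the member analogue of ds-1's C-PRESS `f ∈ C¹` (there: Wilson action, via uniqueness of the DLR state).
  ★★ `tendsto_memberEnergyDensity` — and the finite-volume energy densities `L_n^{−d}⟨S_W⟩` CONVERGE to `−f′(x)` at EVERY `x ∈ (0, βs)` (Griffiths'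
  lemma; no exceptional set); ★★ `deriv_sub_deriv_le_of_tendsto` — `f′` is monotone and `M`-Lipschitz on `(0, βs)` (`f ∈ C^{1,1}`: the limiting energy density is
  Lipschitz in the coupling); `second_difference_le_of_tendsto` — `f(x+h) + f(x−h) − 2f(x) ≤ M h²`.
* ★★ `su2_differentiableAt_limit_oneEighth` — `SU(2)`, `d = 4`, THE LEAD CELL `(β_W, ε) = (1/8, 0.223)` of the data cut, HYPOTHESIS-FREE
  (ds-2's `su2_torusClusteringOnBallUpTo_starVar_oneEighth`): every such limit is differentiable on `(0, 1/16)` (tree coupling `β_W/2`).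
WHAT THIS IS NOT: only inside the door; `M` is a Dobrushin artefact; differentiability, not `C²`/analyticity; nothing about the continuum limit
or a Clay-sense mass gap.  (The matching FLOOR at every coupling — strong convexity uniform on the ball — is `FreeEnergyStrongConvexityBall`.)

References: R. L. Dobrushin, S. B. Shlosman (1985); B. Simon, *The Statistical Mechanics of Lattice Gases* I (1993), §II.1, §II.12.
Everything here is proved; no definition, no named fact. [folklore]
-/

noncomputable section

open MeasureTheory ProbabilityTheory Finset Function Filter Topology
open scoped NNReal ContDiff
open Literature.MathematicalPhysics.QuantumLattice hiding torusNorm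
open Literature.MathematicalPhysics.QuantumFieldTheory hiding ZdEdge Site

namespace Summit.Ventures.YMGap.RobustBall

namespace EnergyVariance

variable {d L N : ℕ} [NeZero L]

/-- Clustering constants may be enlarged: `ClustersWith W β A m → ClustersWith W β (max A 0) m`. [folklore] -/
theorem ClustersWith.max_zero {W : Perturbation d L N} {β A m : ℝ} (h : ClustersWith W β A m) : ClustersWith W β (max A 0) m := by
  intro f g Δf Δg δf δg n hfm hgm hfd hgd hfb hgb hfl hgl hdist
  refine (h f g Δf Δg δf δg n hfm hgm hfd hgd hfb hgb hfl hgl hdist).trans ?_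
  have h1 : 0 ≤ ∑ y ∈ Δg, δg y := Finset.sum_nonneg fun y _ => hgl.nonneg y
  have h2 : 0 ≤ ∑ x ∈ Δf, δf x := Finset.sum_nonneg fun x _ => hfl.nonneg x
  have h3 : 0 ≤ (∑ y ∈ Δg, δg y) * (∑ x ∈ Δf, δf x) * Real.exp (-m * n) := by positivity
  nlinarith [le_max_left A 0, h3]

/-- ★★ **CURVATURE CEILING OF THE MEMBER PRESSURE, uniform in the volume.**  `G = SU(N)`, `d ≥ 1`: if the member `W` clusters with constants
`(A, m)` (`A ≥ 0`, `m > 0`) at every coupling `t ∈ [lo, hi]`, then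
`t ↦ (M/2) t² − L^{−d} log Z_{Λ_L,t,W}` is convex on `[lo, hi]`, `M = 16 N A e^{2m} · #orient² · ((1+e^{−m/d})/(1−e^{−m/d}))^d`. [folklore] -/
theorem convexOn_sq_sub_memberPressure (hd : 1 ≤ d) {W : Perturbation d L N} {A m lo hi : ℝ} (hA : 0 ≤ A) (hm : 0 < m)
    (hW : ∀ t ∈ Set.Icc lo hi, ClustersWith W t A m) :
    ConvexOn ℝ (Set.Icc lo hi) (fun t : ℝ =>
      (16 * N * A * Real.exp (2 * m) * (Fintype.card {ij : Fin d × Fin d // ij.1 < ij.2} : ℝ) *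
            ((1 + Real.exp (-(m / d))) / (1 - Real.exp (-(m / d)))) ^ d *
          (Fintype.card {ij : Fin d × Fin d // ij.1 < ij.2} : ℝ)) / 2 * t ^ 2 -
        ((L : ℝ) ^ d)⁻¹ * Real.log (W.partitionFunction (fundamentalRep (Fin N)) t).toReal) := by
  haveI : SecondCountableTopology (Matrix (Fin N) (Fin N) ℂ) :=
    inferInstanceAs (SecondCountableTopology (Fin N → Fin N → ℂ))
  haveI : SecondCountableTopology (SUN N) := Topology.IsEmbedding.subtypeVal.secondCountableTopology
  set ρN : SUN N →* Matrix (Fin N) (Fin N) ℂ := fundamentalRep (Fin N) with hρN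
  have hρc : Continuous ρN := continuous_fundamentalRep (Fin N)
  set M : ℝ := 16 * N * A * Real.exp (2 * m) * (Fintype.card {ij : Fin d × Fin d // ij.1 < ij.2} : ℝ) *
      ((1 + Real.exp (-(m / d))) / (1 - Real.exp (-(m / d)))) ^ d * (Fintype.card {ij : Fin d × Fin d // ij.1 < ij.2} : ℝ) with hM
  set ν : Measure (GaugeConfig d L (SUN N)) :=
    (Measure.pi fun _ : Edge d L => haarProbability (SUN N)).tilted fun U => -W.total U with hν
  haveI : IsProbabilityMeasure ν := isProbabilityMeasure_tilted (integrable_exp_neg_total W)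
  have hH : Measurable fun U : GaugeConfig d L (SUN N) => -wilsonAction ρN U := (measurable_wilsonAction ρN hρc).neg
  obtain ⟨B, hB⟩ := exists_abs_wilsonAction_le (d := d) (L := L) ρN hρc
  have hB' : ∀ U : GaugeConfig d L (SUN N), |-wilsonAction ρN U| ≤ B := fun U => by rw [abs_neg]; exact hB U
  have hL0 : (0 : ℝ) < (L : ℝ) ^ d := by
    have : (0 : ℝ) < L := by exact_mod_cast Nat.pos_of_ne_zero (NeZero.ne L)
    positivity
  -- the scaled cgf has tilted variances `≤ M`
  have hvar : ∀ t ∈ Set.Icc lo hi, ((L : ℝ) ^ d)⁻¹ * Var[fun U : GaugeConfig d L (SUN N) => -wilsonAction ρN U;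
      ν.tilted fun U => t * -wilsonAction ρN U] ≤ M := by
    intro t ht
    rw [hν, tilted_tilted_eq_perturbedMeasure ρN hρc W t, variance_fun_neg]
    have hV := variance_wilsonAction_le_of_clustersWith hd (hW t ht) hA hm
    rw [inv_mul_le_iff₀ hL0]
    refine hV.trans (le_of_eq ?_)
    rw [hM]; ring
  have hconv := convexOn_sq_sub_mul_cgf hH hB' hvar
  -- `p = L^{-d}(cgf + log Z₀)`
  refine (hconv.add_const (-(((L : ℝ) ^ d)⁻¹ * Real.log (W.partitionFunction ρN 0).toReal))).congr fun t _ => ?_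
  simp only [Pi.add_apply, hν, log_partitionFunction_eq_cgf_add ρN hρc W t]
  ring

/-- ★★ **ON THE BALL, UP TO `β⋆`.**  The currency `TorusClusteringOnBallUpTo N d βs ε₀ ε₁ r A m` (`A ≥ 0`, `m > 0`, `d ≥ 1`) gives the curvature
ceiling on `[0, βs]` for EVERY member `W ∈ ClusterDomainFR ε₀ ε₁ r` on every torus `L ≥ 3`, with ONE `M`. [folklore] -/
theorem convexOn_sq_sub_memberPressure_onBallUpTo (hd : 1 ≤ d) {βs ε₀ ε₁ A m : ℝ} {r : ℕ}
    (h : TorusClusteringOnBallUpTo N d βs ε₀ ε₁ r A m) (hA : 0 ≤ A) (hm : 0 < m) (hL : 3 ≤ L) {W : Perturbation d L N}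
    (hW : W ∈ ClusterDomainFR ε₀ ε₁ r) :
    ConvexOn ℝ (Set.Icc 0 βs) (fun t : ℝ =>
      (16 * N * A * Real.exp (2 * m) * (Fintype.card {ij : Fin d × Fin d // ij.1 < ij.2} : ℝ) *
            ((1 + Real.exp (-(m / d))) / (1 - Real.exp (-(m / d)))) ^ d *
          (Fintype.card {ij : Fin d × Fin d // ij.1 < ij.2} : ℝ)) / 2 * t ^ 2 -
        ((L : ℝ) ^ d)⁻¹ * Real.log (W.partitionFunction (fundamentalRep (Fin N)) t).toReal) :=
  convexOn_sq_sub_memberPressure hd hA hm fun t ht => h t ht.1 ht.2 L hL W hW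

/-- ★★ **FINITE VOLUME: the member's mean energy density is `M`-Lipschitz in the coupling inside the door**, uniformly in `L` and in the member:
if `W` clusters with `(A, m)` at every coupling of `[lo, hi]`, then for `x < y` in `[lo, hi]`,
`L^{−d}(⟨S_W⟩_{Λ_L,x,W} − ⟨S_W⟩_{Λ_L,y,W}) ≤ M (y − x)` (the matching floor `≥ m_(b)(y − x)`, every coupling, is
`TorusEnergyStrictMonoBall.memberEnergy_decrement_ge`). [folklore] -/
theorem memberEnergy_decrement_le (hd : 1 ≤ d) {W : Perturbation d L N} {A m lo hi : ℝ} (hA : 0 ≤ A) (hm : 0 < m)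
    (hW : ∀ t ∈ Set.Icc lo hi, ClustersWith W t A m) {x y : ℝ} (hx : x ∈ Set.Icc lo hi) (hy : y ∈ Set.Icc lo hi) (hxy : x < y) :
    ((L : ℝ) ^ d)⁻¹ * (∫ U, wilsonAction (fundamentalRep (Fin N)) U ∂W.perturbedMeasure (fundamentalRep (Fin N)) x -
        ∫ U, wilsonAction (fundamentalRep (Fin N)) U ∂W.perturbedMeasure (fundamentalRep (Fin N)) y) ≤
      (16 * N * A * Real.exp (2 * m) * (Fintype.card {ij : Fin d × Fin d // ij.1 < ij.2} : ℝ) *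
            ((1 + Real.exp (-(m / d))) / (1 - Real.exp (-(m / d)))) ^ d *
          (Fintype.card {ij : Fin d × Fin d // ij.1 < ij.2} : ℝ)) * (y - x) := by
  set M : ℝ := 16 * N * A * Real.exp (2 * m) * (Fintype.card {ij : Fin d × Fin d // ij.1 < ij.2} : ℝ) *
      ((1 + Real.exp (-(m / d))) / (1 - Real.exp (-(m / d)))) ^ d * (Fintype.card {ij : Fin d × Fin d // ij.1 < ij.2} : ℝ) with hM
  have hρc : Continuous (fundamentalRep (Fin N) : SUN N →* Matrix (Fin N) (Fin N) ℂ) := continuous_fundamentalRep (Fin N)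
  have hconv := convexOn_sq_sub_memberPressure (L := L) (N := N) hd hA hm hW
  set p : ℝ → ℝ := fun s => ((L : ℝ) ^ d)⁻¹ * Real.log (W.partitionFunction (fundamentalRep (Fin N)) s).toReal with hp
  have hgx : HasDerivAt (fun t => M / 2 * t ^ 2 - p t)
      (M * x - -(((L : ℝ) ^ d)⁻¹ * ∫ U, wilsonAction (fundamentalRep (Fin N)) U ∂W.perturbedMeasure (fundamentalRep (Fin N)) x)) x :=
    (hasDerivAt_half_mul_sq M x).fun_sub (hasDerivAt_memberPressure (fundamentalRep (Fin N)) hρc W x)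
  have hgy : HasDerivAt (fun t => M / 2 * t ^ 2 - p t)
      (M * y - -(((L : ℝ) ^ d)⁻¹ * ∫ U, wilsonAction (fundamentalRep (Fin N)) U ∂W.perturbedMeasure (fundamentalRep (Fin N)) y)) y :=
    (hasDerivAt_half_mul_sq M y).fun_sub (hasDerivAt_memberPressure (fundamentalRep (Fin N)) hρc W y)
  have h1 := hconv.le_slope_of_hasDerivAt hx hy hxy hgx
  have h2 := hconv.slope_le_of_hasDerivAt hx hy hxy hgy
  have h := h1.trans h2
  rw [mul_sub]
  nlinarith [h, hxy]

/-! ### No first-order transition on the ball inside the door -/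

/-- **The two convexities of a limit of member pressures inside the door**: `f` is convex (limit of convex pressures) and `(M/2)t² − f` is convex
(limit of the curvature ceiling). [folklore] -/
theorem convex_pair_of_tendsto_memberPressure (hd : 1 ≤ d) {βs ε₀ ε₁ A m : ℝ} {r : ℕ}
    (h : TorusClusteringOnBallUpTo N d βs ε₀ ε₁ r A m) (hA : 0 ≤ A) (hm : 0 < m)
    {Ls : ℕ → ℕ} [∀ n, NeZero (Ls n)] (hLs3 : ∀ n, 3 ≤ Ls n)
    {Ws : (n : ℕ) → Perturbation d (Ls n) N} (hWs : ∀ n, Ws n ∈ ClusterDomainFR ε₀ ε₁ r) {f : ℝ → ℝ}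
    (hlim : ∀ t ∈ Set.Icc 0 βs,
      Tendsto (fun n => (((Ls n) : ℝ) ^ d)⁻¹ * Real.log ((Ws n).partitionFunction (fundamentalRep (Fin N)) t).toReal) atTop (𝓝 (f t))) :
    ConvexOn ℝ (Set.Icc 0 βs) (fun t => f t - 0 / 2 * t ^ 2) ∧
      ConvexOn ℝ (Set.Icc 0 βs) (fun t =>
        (16 * N * A * Real.exp (2 * m) * (Fintype.card {ij : Fin d × Fin d // ij.1 < ij.2} : ℝ) *
            ((1 + Real.exp (-(m / d))) / (1 - Real.exp (-(m / d)))) ^ d * (Fintype.card {ij : Fin d × Fin d // ij.1 < ij.2} : ℝ)) / 2 * t ^ 2 -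
          f t) := by
  have hρc : Continuous (fundamentalRep (Fin N) : SUN N →* Matrix (Fin N) (Fin N) ℂ) := continuous_fundamentalRep (Fin N)
  constructor
  · refine convexOn_of_tendsto (convex_Icc _ _)
      (p := fun n t => (((Ls n) : ℝ) ^ d)⁻¹ * Real.log ((Ws n).partitionFunction (fundamentalRep (Fin N)) t).toReal - 0 / 2 * t ^ 2)
      (Filter.Eventually.of_forall fun n => ?_) fun t ht => (hlim t ht).sub_const _
    refine (convexOn_memberPressure (fundamentalRep (Fin N)) hρc (Ws n) 0 βs).congr fun t _ => ?_
    ring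
  · refine convexOn_of_tendsto (convex_Icc _ _)
      (p := fun n t => (16 * N * A * Real.exp (2 * m) * (Fintype.card {ij : Fin d × Fin d // ij.1 < ij.2} : ℝ) *
            ((1 + Real.exp (-(m / d))) / (1 - Real.exp (-(m / d)))) ^ d * (Fintype.card {ij : Fin d × Fin d // ij.1 < ij.2} : ℝ)) / 2 * t ^ 2 -
        (((Ls n) : ℝ) ^ d)⁻¹ * Real.log ((Ws n).partitionFunction (fundamentalRep (Fin N)) t).toReal)
      (Filter.Eventually.of_forall fun n => ?_) fun t ht => (hlim t ht).const_sub _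
    exact convexOn_sq_sub_memberPressure_onBallUpTo hd h hA hm (hLs3 n) (hWs n)

/-- ★★★ **NO FIRST-ORDER TRANSITION ON THE BALL INSIDE THE DOOR: every thermodynamic limit of member free energies is DIFFERENTIABLE.**
`G = SU(N)`, `d ≥ 1`, the ball `ClusterDomainFR ε₀ ε₁ r` carrying `TorusClusteringOnBallUpTo N d βs ε₀ ε₁ r A m` (`A ≥ 0`, `m > 0`); if member
pressures `p_{L_n,W_n}` (`L_n ≥ 3`) converge pointwise to `f` on `[0, βs]`, then `f` is differentiable at every `x ∈ (0, βs)`. [folklore] -/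
theorem differentiableAt_of_tendsto_memberPressure (hd : 1 ≤ d) {βs ε₀ ε₁ A m : ℝ} {r : ℕ}
    (h : TorusClusteringOnBallUpTo N d βs ε₀ ε₁ r A m) (hA : 0 ≤ A) (hm : 0 < m)
    {Ls : ℕ → ℕ} [∀ n, NeZero (Ls n)] (hLs3 : ∀ n, 3 ≤ Ls n)
    {Ws : (n : ℕ) → Perturbation d (Ls n) N} (hWs : ∀ n, Ws n ∈ ClusterDomainFR ε₀ ε₁ r) {f : ℝ → ℝ}
    (hlim : ∀ t ∈ Set.Icc 0 βs,
      Tendsto (fun n => (((Ls n) : ℝ) ^ d)⁻¹ * Real.log ((Ws n).partitionFunction (fundamentalRep (Fin N)) t).toReal) atTop (𝓝 (f t)))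
    {x : ℝ} (hx : x ∈ Set.Ioo 0 βs) : DifferentiableAt ℝ f x := by
  obtain ⟨hlo, hhi⟩ := convex_pair_of_tendsto_memberPressure hd h hA hm hLs3 hWs hlim
  refine differentiableAt_of_two_sided_convex hlo hhi ?_
  rw [interior_Icc]
  exact hx

/-- ★★ **The limiting energy density is Lipschitz in the coupling**: under the same hypotheses, for `x ≤ y` in `(0, βs)`,
`0 ≤ f′(y) − f′(x) ≤ M (y − x)` (`f ∈ C^{1,1}` inside the door; `−f′` = the limiting energy density wherever the finite-volume energies converge). [folklore] -/
theorem deriv_sub_deriv_le_of_tendsto (hd : 1 ≤ d) {βs ε₀ ε₁ A m : ℝ} {r : ℕ}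
    (h : TorusClusteringOnBallUpTo N d βs ε₀ ε₁ r A m) (hA : 0 ≤ A) (hm : 0 < m)
    {Ls : ℕ → ℕ} [∀ n, NeZero (Ls n)] (hLs3 : ∀ n, 3 ≤ Ls n)
    {Ws : (n : ℕ) → Perturbation d (Ls n) N} (hWs : ∀ n, Ws n ∈ ClusterDomainFR ε₀ ε₁ r) {f : ℝ → ℝ}
    (hlim : ∀ t ∈ Set.Icc 0 βs,
      Tendsto (fun n => (((Ls n) : ℝ) ^ d)⁻¹ * Real.log ((Ws n).partitionFunction (fundamentalRep (Fin N)) t).toReal) atTop (𝓝 (f t)))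
    {x y : ℝ} (hx : x ∈ Set.Ioo 0 βs) (hy : y ∈ Set.Ioo 0 βs) (hxy : x ≤ y) :
    0 ≤ deriv f y - deriv f x ∧ deriv f y - deriv f x ≤
      (16 * N * A * Real.exp (2 * m) * (Fintype.card {ij : Fin d × Fin d // ij.1 < ij.2} : ℝ) *
          ((1 + Real.exp (-(m / d))) / (1 - Real.exp (-(m / d)))) ^ d * (Fintype.card {ij : Fin d × Fin d // ij.1 < ij.2} : ℝ)) * (y - x) := by
  obtain ⟨hlo, hhi⟩ := convex_pair_of_tendsto_memberPressure hd h hA hm hLs3 hWs hlim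
  have k := deriv_sub_deriv_two_sided (convex_Icc 0 βs) hlo hhi (by rw [interior_Icc]; exact hx) (by rw [interior_Icc]; exact hy) hxy
  rw [zero_mul] at k
  exact k

/-- ★★ **THE ENERGY DENSITY HAS A THERMODYNAMIC LIMIT AT EVERY COUPLING INSIDE THE DOOR — no exceptional set.**  Under the same
hypotheses, for every `x ∈ (0, βs)`: `L_n^{−d} ⟨S_W⟩_{Λ_{L_n},x,W_n} → −f′(x)` (Griffiths' lemma for the convex member pressures, `Missing.tendsto_deriv_of_convex`,
at a point where the limit is differentiable — which is every interior point by `differentiableAt_of_tendsto_memberPressure`). [folklore] -/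
theorem tendsto_memberEnergyDensity (hd : 1 ≤ d) {βs ε₀ ε₁ A m : ℝ} {r : ℕ}
    (h : TorusClusteringOnBallUpTo N d βs ε₀ ε₁ r A m) (hA : 0 ≤ A) (hm : 0 < m)
    {Ls : ℕ → ℕ} [∀ n, NeZero (Ls n)] (hLs3 : ∀ n, 3 ≤ Ls n)
    {Ws : (n : ℕ) → Perturbation d (Ls n) N} (hWs : ∀ n, Ws n ∈ ClusterDomainFR ε₀ ε₁ r) {f : ℝ → ℝ}
    (hlim : ∀ t ∈ Set.Icc 0 βs,
      Tendsto (fun n => (((Ls n) : ℝ) ^ d)⁻¹ * Real.log ((Ws n).partitionFunction (fundamentalRep (Fin N)) t).toReal) atTop (𝓝 (f t)))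
    {x : ℝ} (hx : x ∈ Set.Ioo 0 βs) :
    Tendsto (fun n => (((Ls n) : ℝ) ^ d)⁻¹ *
        ∫ U, wilsonAction (fundamentalRep (Fin N)) U ∂(Ws n).perturbedMeasure (fundamentalRep (Fin N)) x) atTop (𝓝 (-deriv f x)) := by
  have hdiff := differentiableAt_of_tendsto_memberPressure hd h hA hm hLs3 hWs hlim hx
  have hρc : Continuous (fundamentalRep (Fin N) : SUN N →* Matrix (Fin N) (Fin N) ℂ) := continuous_fundamentalRep (Fin N)
  have key := Literature.MathematicalPhysics.QuantumFieldTheory.Balaban1983to89.Missing.tendsto_deriv_of_convex (S := Set.Icc 0 βs)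
    (p := fun n t => (((Ls n) : ℝ) ^ d)⁻¹ * Real.log ((Ws n).partitionFunction (fundamentalRep (Fin N)) t).toReal) (q := f)
    (fun n => convexOn_memberPressure (fundamentalRep (Fin N)) hρc (Ws n) 0 βs) (by rw [interior_Icc]; exact hx) hlim hdiff.hasDerivAt
    (fun n => hasDerivAt_memberPressure (fundamentalRep (Fin N)) hρc (Ws n) x)
  have e : (fun n => (((Ls n) : ℝ) ^ d)⁻¹ *
      ∫ U, wilsonAction (fundamentalRep (Fin N)) U ∂(Ws n).perturbedMeasure (fundamentalRep (Fin N)) x) =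
      fun n => -(-((((Ls n) : ℝ) ^ d)⁻¹ *
        ∫ U, wilsonAction (fundamentalRep (Fin N)) U ∂(Ws n).perturbedMeasure (fundamentalRep (Fin N)) x)) := by
    funext n; rw [neg_neg]
  rw [e]
  exact key.neg

/-- ★★ **EVERY THERMODYNAMIC LIMIT OF MEMBER FREE ENERGIES IS `C¹` INSIDE THE DOOR** (indeed `C^{1,1}`: `f′` is `M`-Lipschitz by
`deriv_sub_deriv_le_of_tendsto`): `ContDiffOn ℝ 1 f (Ioo 0 βs)`. [folklore] -/
theorem contDiffOn_one_of_tendsto_memberPressure (hd : 1 ≤ d) {βs ε₀ ε₁ A m : ℝ} {r : ℕ}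
    (h : TorusClusteringOnBallUpTo N d βs ε₀ ε₁ r A m) (hA : 0 ≤ A) (hm : 0 < m)
    {Ls : ℕ → ℕ} [∀ n, NeZero (Ls n)] (hLs3 : ∀ n, 3 ≤ Ls n)
    {Ws : (n : ℕ) → Perturbation d (Ls n) N} (hWs : ∀ n, Ws n ∈ ClusterDomainFR ε₀ ε₁ r) {f : ℝ → ℝ}
    (hlim : ∀ t ∈ Set.Icc 0 βs,
      Tendsto (fun n => (((Ls n) : ℝ) ^ d)⁻¹ * Real.log ((Ws n).partitionFunction (fundamentalRep (Fin N)) t).toReal) atTop (𝓝 (f t))) :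
    ContDiffOn ℝ 1 f (Set.Ioo 0 βs) := by
  set M : ℝ := 16 * N * A * Real.exp (2 * m) * (Fintype.card {ij : Fin d × Fin d // ij.1 < ij.2} : ℝ) *
      ((1 + Real.exp (-(m / d))) / (1 - Real.exp (-(m / d)))) ^ d * (Fintype.card {ij : Fin d × Fin d // ij.1 < ij.2} : ℝ) with hM
  have hm1 : Real.exp (-(m / d)) < 1 := Real.exp_lt_one_iff.2 (by
    have : (0 : ℝ) < d := by exact_mod_cast hd
    rw [neg_lt_zero]; exact div_pos hm this)
  have hM0 : 0 ≤ M := by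
    have : 0 < 1 - Real.exp (-(m / d)) := by linarith
    positivity
  have hdiff : ∀ x ∈ Set.Ioo 0 βs, DifferentiableAt ℝ f x := fun x hx =>
    differentiableAt_of_tendsto_memberPressure hd h hA hm hLs3 hWs hlim hx
  -- `f′` is `M`-Lipschitz on the open window
  have hlip : LipschitzOnWith M.toNNReal (deriv f) (Set.Ioo 0 βs) := by
    refine LipschitzOnWith.of_dist_le_mul fun x hx y hy => ?_
    rw [Real.coe_toNNReal _ hM0, Real.dist_eq, Real.dist_eq]
    rcases le_total x y with hxy | hxy
    · have k := deriv_sub_deriv_le_of_tendsto hd h hA hm hLs3 hWs hlim hx hy hxy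
      rw [abs_sub_comm, abs_of_nonneg k.1, abs_sub_comm, abs_of_nonneg (by linarith : 0 ≤ y - x)]
      exact k.2
    · have k := deriv_sub_deriv_le_of_tendsto hd h hA hm hLs3 hWs hlim hy hx hxy
      rw [abs_of_nonneg k.1, abs_of_nonneg (by linarith : 0 ≤ x - y)]
      exact k.2
  rw [show (1 : WithTop ℕ∞) = 0 + 1 from (zero_add 1).symm, contDiffOn_succ_iff_deriv_of_isOpen isOpen_Ioo]
  refine ⟨fun t ht => (hdiff t ht).differentiableWithinAt, fun h' => absurd h' (by simp), ?_⟩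
  rw [contDiffOn_zero]
  exact hlip.continuousOn

/-- ★ **The curvature ceiling passes to the limit**: under the same hypotheses, `f(x+h) + f(x−h) − 2f(x) ≤ M h²` whenever `x ± h ∈ [0, βs]`. [folklore] -/
theorem second_difference_le_of_tendsto (hd : 1 ≤ d) {βs ε₀ ε₁ A m : ℝ} {r : ℕ}
    (h : TorusClusteringOnBallUpTo N d βs ε₀ ε₁ r A m) (hA : 0 ≤ A) (hm : 0 < m)
    {Ls : ℕ → ℕ} [∀ n, NeZero (Ls n)] (hLs3 : ∀ n, 3 ≤ Ls n)
    {Ws : (n : ℕ) → Perturbation d (Ls n) N} (hWs : ∀ n, Ws n ∈ ClusterDomainFR ε₀ ε₁ r) {f : ℝ → ℝ}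
    (hlim : ∀ t ∈ Set.Icc 0 βs,
      Tendsto (fun n => (((Ls n) : ℝ) ^ d)⁻¹ * Real.log ((Ws n).partitionFunction (fundamentalRep (Fin N)) t).toReal) atTop (𝓝 (f t)))
    {x hh : ℝ} (h1 : x - hh ∈ Set.Icc 0 βs) (h2 : x + hh ∈ Set.Icc 0 βs) :
    f (x + hh) + f (x - hh) - 2 * f x ≤
      (16 * N * A * Real.exp (2 * m) * (Fintype.card {ij : Fin d × Fin d // ij.1 < ij.2} : ℝ) *
          ((1 + Real.exp (-(m / d))) / (1 - Real.exp (-(m / d)))) ^ d * (Fintype.card {ij : Fin d × Fin d // ij.1 < ij.2} : ℝ)) * hh ^ 2 := by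
  obtain ⟨hlo, hhi⟩ := convex_pair_of_tendsto_memberPressure hd h hA hm hLs3 hWs hlim
  exact (second_difference_two_sided hlo hhi h1 h2).2

/-- ★★ **`SU(2)`, `d = 4`, LEAD CELL `(β_W, ε) = (1/8, 0.223)`, HYPOTHESIS-FREE**: every pointwise limit on `[0, 1/16]` (tree coupling) of pressures of
members `W_n ∈ ClusterDomainFR (223/500) (223/1000) r` on tori `L_n ≥ 3` is differentiable on `(0, 1/16)` — no first-order transition on the lead
cell of the robust ball. [folklore] -/
theorem su2_differentiableAt_limit_oneEighth (r : ℕ) {Ls : ℕ → ℕ} [∀ n, NeZero (Ls n)] (hLs3 : ∀ n, 3 ≤ Ls n)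
    {Ws : (n : ℕ) → Perturbation 4 (Ls n) 2} (hWs : ∀ n, Ws n ∈ ClusterDomainFR (223 / 500) (223 / 1000) r)
    {f : ℝ → ℝ} (hlim : ∀ t ∈ Set.Icc (0 : ℝ) (1 / 16), Tendsto (fun n => (((Ls n) : ℝ) ^ 4)⁻¹ *
      Real.log ((Ws n).partitionFunction (fundamentalRep (Fin 2)) t).toReal) atTop (𝓝 (f t)))
    {x : ℝ} (hx : x ∈ Set.Ioo (0 : ℝ) (1 / 16)) : DifferentiableAt ℝ f x := by
  obtain ⟨A, m, hm, hUp⟩ := su2_torusClusteringOnBallUpTo_starVar_oneEighth r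
  have hUp' : TorusClusteringOnBallUpTo 2 4 (1 / 16) (223 / 500) (223 / 1000) r (max A 0) m :=
    fun β hβ0 hβ L _ hL W hW => ClustersWith.max_zero (hUp β hβ0 hβ L hL W hW)
  exact differentiableAt_of_tendsto_memberPressure (d := 4) (N := 2) (by norm_num) hUp' (le_max_right A 0) hm hLs3 hWs hlim hx

end EnergyVariance

end Summit.Ventures.YMGap.RobustBall
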